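import Mathlib
import Literature.NumberTheory.Sieve.SelbergSymmetryFormula
import Literature.NumberTheory.LFunctions.SiegelWalfisz

/-!
# The `χ₆`-twisted von Mangoldt function: Siegel–Walfisz and a hyperbola bound for `χ₆Λ ⋆ χ₆Λ`

Elementary, fully proved estimates around the Dirichlet convolution `Λ ⋆ Λ` and its twist by the
non-trivial character `χ₆` mod `6` (written as the real-valued `chi6`), packaged for the parity-summit
refutation `Summits/Parity/GeneralizedHardyLittlewood/Theorems/PrimeDeterminantCellsConvMomentLevelOneRefutation.lean`
(route review rreview-0815T14-0, item stmt-Parity-9541) but stated without reference to any route: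

* `sum_vonMangoldt_conv_le`: `∑_{k ≤ K} (Λ ⋆ Λ)(k) ≤ 2K log K + 170K` (Selberg's formula,
  `SelbergSymmetry.selberg_symmetry_formula'`, [Apostol1976] Thm 4.18).
* `twist = χ₆Λ`, `twistSum M = ∑_{m ≤ M} χ₆(m)Λ(m) = ψ(M;6,1) − ψ(M;6,5)` (`twistSum_eq`) and the
  Siegel–Walfisz consequence `exists_twistSum_bound`: `|twistSum M| ≤ D·M/log² M` for `M ≥ 16`
  (tree: `Literature.NumberTheory.LFunctions.siegel_walfisz_holds`, `q = 6`, `A = 2`).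
* `hyperbola_bound`: the symmetric Dirichlet hyperbola method for `∑_{k ≤ K} (χ₆Λ ⋆ χ₆Λ)(k)` with the
  truncations `twistLow`/`twistHigh` at `s = ⌊√K⌋`, giving `O(K/log K)`; `twist_conv_sum_eventually`:
  `|∑_{2 < k ≤ ⌊x⌋+2} (χ₆Λ ⋆ χ₆Λ)(k)| ≤ x/100` for large `x` (Mertens' estimate
  `SelbergSymmetry.abs_sum_vonMangoldt_div_sub_log_le` supplies `∑_{n ≤ s} Λ(n)/n ≤ log s + 6`).
* `oddMultThree k = 1_{k odd, 3 ∣ k}(Λ ⋆ Λ)(k)` and the lower bound `oddMultThree_sum_eventually`: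
  `∑_{2 < k ≤ ⌊x⌋+2} oddMultThree k ≥ 0.22·x` for large `x` (pairs `(3, p)` with `p` an odd prime and
  Mathlib's `Chebyshev.theta_ge`; `log 3 ≥ 1`, `log 2 ≥ 0.6931`).

Design: `χ₆` is handled as an explicit `ℕ → ℝ` function of `n % 6` (complete multiplicativity by a
36-case check), avoiding the `DirichletCharacter` API; all constants are crude but explicit. Nothing here is
new mathematics. [folklore]
-/

noncomputable section

open Finset Filter
open scoped ArithmeticFunction.vonMangoldt Chebyshev

namespace Literature.NumberTheory.Sieve

namespace TwistedModSix

/-! ### Nonnegativity and Selberg-type size of `Λ ⋆ Λ` -/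

/-- `(Λ ⋆ Λ)(k) ≥ 0`. [folklore] -/
theorem vonMangoldt_conv_nonneg (k : ℕ) : 0 ≤ (Λ * Λ) k := by
  rw [ArithmeticFunction.mul_apply]
  exact Finset.sum_nonneg fun cd _ =>
    mul_nonneg ArithmeticFunction.vonMangoldt_nonneg ArithmeticFunction.vonMangoldt_nonneg


/-- `∑_{k ≤ K} (Λ ⋆ Λ)(k) ≤ 2K log K + 170 K` (Selberg's formula, tree). [folklore] -/
theorem sum_vonMangoldt_conv_le (K : ℕ) : ∑ k ∈ Ioc 0 K, (Λ * Λ) k ≤ 2 * K * Real.log K + 170 * K := by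
  rcases Nat.eq_zero_or_pos K with rfl | hK
  · simp
  have hK1 : (1:ℝ) ≤ K := by exact_mod_cast hK
  have h := Literature.NumberTheory.Sieve.SelbergSymmetry.selberg_symmetry_formula' hK1
  rw [Nat.floor_natCast] at h
  have hlog : 0 ≤ ∑ n ∈ Ioc 0 K, Λ n * Real.log n :=
    Finset.sum_nonneg fun n _ => mul_nonneg ArithmeticFunction.vonMangoldt_nonneg
      (Real.log_natCast_nonneg n)
  have := (abs_le.1 h).2
  linarith


/-! ### The character mod 6 and the twisted von Mangoldt function -/

/-- The non-trivial Dirichlet character mod `6` as a real-valued function `χ₆`. [folklore] -/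
def chi6 (n : ℕ) : ℝ := if n % 6 = 1 then 1 else if n % 6 = 5 then -1 else 0

/-- `χ₆` depends only on the residue mod `6`. [folklore] -/
theorem chi6_mod (n : ℕ) : chi6 n = chi6 (n % 6) := by
  unfold chi6; rw [Nat.mod_mod]

/-- `χ₆` is completely multiplicative (36 residue cases). [folklore] -/
theorem chi6_mul (c d : ℕ) : chi6 (c * d) = chi6 c * chi6 d := by
  rw [chi6_mod, chi6_mod c, chi6_mod d, Nat.mul_mod]
  have hc : c % 6 < 6 := Nat.mod_lt _ (by norm_num)
  have hd : d % 6 < 6 := Nat.mod_lt _ (by norm_num)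
  generalize c % 6 = a at *
  generalize d % 6 = b at *
  interval_cases a <;> interval_cases b <;> simp [chi6]

/-- `|χ₆| ≤ 1`. [folklore] -/
theorem abs_chi6_le (n : ℕ) : |chi6 n| ≤ 1 := by
  unfold chi6; split_ifs <;> simp

/-- `twist = χ₆ · Λ` as an arithmetic function. [folklore] -/
def twist : ArithmeticFunction ℝ := ⟨fun n => chi6 n * Λ n, by simp [chi6]⟩

/-- Unfolding of `twist = χ₆ Λ`. [folklore] -/
theorem twist_apply (n : ℕ) : twist n = chi6 n * Λ n := rfl

/-- `|χ₆ Λ| ≤ Λ`. [folklore] -/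
theorem abs_twist_le (n : ℕ) : |twist n| ≤ Λ n := by
  rw [twist_apply, abs_mul, abs_of_nonneg ArithmeticFunction.vonMangoldt_nonneg]
  exact mul_le_of_le_one_left ArithmeticFunction.vonMangoldt_nonneg (abs_chi6_le n)

/-- `(χ₆Λ ⋆ χ₆Λ)(k) = χ₆(k) (Λ ⋆ Λ)(k)` by complete multiplicativity. [folklore] -/
theorem twist_mul_twist_apply (k : ℕ) : (twist * twist) k = chi6 k * (Λ * Λ) k := by
  rw [ArithmeticFunction.mul_apply, ArithmeticFunction.mul_apply, Finset.mul_sum]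
  refine Finset.sum_congr rfl fun cd hcd => ?_
  rw [Nat.mem_divisorsAntidiagonal] at hcd
  rw [twist_apply, twist_apply, ← hcd.1, chi6_mul]
  ring

/-- `twistSum(M) = ∑_{m ≤ M} χ₆(m) Λ(m)` (`= ψ(M; 6, 1) − ψ(M; 6, 5)`, `twistSum_eq`). [folklore] -/
def twistSum (M : ℕ) : ℝ := ∑ m ∈ Ioc 0 M, twist m

/-- `|twistSum(M)| ≤ ψ(M)`. [folklore] -/
theorem abs_twistSum_le_psi (M : ℕ) : |twistSum M| ≤ ψ M := by
  unfold twistSum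
  rw [Chebyshev.psi, Nat.floor_natCast]
  exact (Finset.abs_sum_le_sum_abs _ _).trans (Finset.sum_le_sum fun m _ => abs_twist_le m)

/-! ### Siegel–Walfisz input -/

/-- The unit `5 = −1` of `ZMod 6`. [folklore] -/
def unitFive : (ZMod 6)ˣ := ⟨5, 5, by decide, by decide⟩

/-- `χ₆(m)Λ(m) = Λ·1_{m ≡ 1 (6)} − Λ·1_{m ≡ 5 (6)}`. [folklore] -/
theorem chi6_mul_vonMangoldt_eq (m : ℕ) :
    chi6 m * Λ m = (if (m : ZMod 6) = ((1 : (ZMod 6)ˣ) : ZMod 6) then Λ m else 0) -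
      (if (m : ZMod 6) = ((unitFive : (ZMod 6)ˣ) : ZMod 6) then Λ m else 0) := by
  rw [chi6_mod, ← ZMod.natCast_mod m 6]
  have hm : m % 6 < 6 := Nat.mod_lt _ (by norm_num)
  generalize m % 6 = r at *
  interval_cases r <;> simp +decide [chi6]

/-- `ψ(M; 6, a)` as a sum over `0 < m ≤ M`. [folklore] -/
theorem chebyshevPsiMod_six_natCast (a : ZMod 6) (M : ℕ) :
    Literature.NumberTheory.Sieve.ParityWave0.chebyshevPsiMod 6 a M =
      ∑ m ∈ Ioc 0 M, (if (m : ZMod 6) = a then Λ m else 0) := by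
  rw [Literature.NumberTheory.Sieve.ParityWave0.chebyshevPsiMod, Nat.floor_natCast]
  have h0 : ∀ m ∈ Finset.range (M + 1), m ∉ Ioc 0 M →
      ArithmeticFunction.vonMangoldt.residueClass a m = 0 := by
    intro m hm hm'
    have : m = 0 := by
      rw [Finset.mem_range] at hm; rw [Finset.mem_Ioc] at hm'; omega
    subst this
    simp [ArithmeticFunction.vonMangoldt.residueClass, Set.indicator_apply]
  rw [← Finset.sum_subset (fun m hm => by
        rw [Finset.mem_Ioc] at hm; rw [Finset.mem_range]; omega) h0]
  refine Finset.sum_congr rfl fun m _ => ?_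
  simp only [ArithmeticFunction.vonMangoldt.residueClass, Set.indicator_apply, Set.mem_setOf_eq]

/-- `twistSum(M) = ψ(M; 6, 1) − ψ(M; 6, 5)`. [folklore] -/
theorem twistSum_eq (M : ℕ) : twistSum M =
    Literature.NumberTheory.Sieve.ParityWave0.chebyshevPsiMod 6 ((1 : (ZMod 6)ˣ) : ZMod 6) M -
      Literature.NumberTheory.Sieve.ParityWave0.chebyshevPsiMod 6 ((unitFive : (ZMod 6)ˣ) : ZMod 6) M := by
  rw [chebyshevPsiMod_six_natCast, chebyshevPsiMod_six_natCast, ← Finset.sum_sub_distrib]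
  unfold twistSum
  exact Finset.sum_congr rfl fun m _ => chi6_mul_vonMangoldt_eq m

/-- Siegel–Walfisz (`q = 6`, `A = 2`, tree `siegel_walfisz_holds`): `|twistSum(M)| ≤ D M / log² M` for `M ≥ 16`. [folklore] -/
theorem exists_twistSum_bound : ∃ D : ℝ, 0 ≤ D ∧ ∀ M : ℕ, 16 ≤ M → |twistSum M| ≤ D * M / Real.log M ^ 2 := by
  obtain ⟨C, hC⟩ := Literature.NumberTheory.LFunctions.siegel_walfisz_holds 2 two_pos
  refine ⟨2 * max C 0, by positivity, fun M hM => ?_⟩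
  have hM2 : (2:ℝ) ≤ M := by exact_mod_cast (le_trans (by norm_num) hM)
  have hMpos : (0:ℝ) < M := by linarith
  have hlog16 : 4 * Real.log 2 ≤ Real.log M := by
    rw [← Real.log_rpow (by norm_num : (0:ℝ) < 2)]
    apply Real.log_le_log (by positivity)
    have : (2:ℝ) ^ (4:ℝ) = 16 := by norm_num
    rw [this]; exact_mod_cast hM
  have hlogpos : 0 < Real.log M := by linarith [Real.log_two_gt_d9]
  have h6 : (6:ℝ) ≤ Real.log M ^ (2:ℝ) := by
    rw [Real.rpow_two]; nlinarith [Real.log_two_gt_d9]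
  have h1 := hC M hM2 6 (by norm_num) (by exact_mod_cast h6) 1
  have h5 := hC M hM2 6 (by norm_num) (by exact_mod_cast h6) unitFive
  have hφ : ((Nat.totient 6 : ℕ) : ℝ) = 2 := by
    rw [show Nat.totient 6 = 2 by decide]; norm_num
  rw [hφ, Real.rpow_two] at h1 h5
  rw [twistSum_eq]
  have hC0 : C ≤ max C 0 := le_max_left _ _
  have hkey : C * M / Real.log M ^ 2 ≤ max C 0 * M / Real.log M ^ 2 := by
    apply div_le_div_of_nonneg_right _ (by positivity)
    exact mul_le_mul_of_nonneg_right hC0 hMpos.le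
  calc |Literature.NumberTheory.Sieve.ParityWave0.chebyshevPsiMod 6 ((1 : (ZMod 6)ˣ) : ZMod 6) M -
        Literature.NumberTheory.Sieve.ParityWave0.chebyshevPsiMod 6 ((unitFive : (ZMod 6)ˣ) : ZMod 6) M|
      = |(Literature.NumberTheory.Sieve.ParityWave0.chebyshevPsiMod 6 ((1 : (ZMod 6)ˣ) : ZMod 6) M - M / 2) -
          (Literature.NumberTheory.Sieve.ParityWave0.chebyshevPsiMod 6 ((unitFive : (ZMod 6)ˣ) : ZMod 6) M - M / 2)| := by
        ring_nf
    _ ≤ |Literature.NumberTheory.Sieve.ParityWave0.chebyshevPsiMod 6 ((1 : (ZMod 6)ˣ) : ZMod 6) M - M / 2| +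
          |Literature.NumberTheory.Sieve.ParityWave0.chebyshevPsiMod 6 ((unitFive : (ZMod 6)ˣ) : ZMod 6) M - M / 2| :=
        abs_sub _ _
    _ ≤ max C 0 * M / Real.log M ^ 2 + max C 0 * M / Real.log M ^ 2 := add_le_add (h1.trans hkey) (h5.trans hkey)
    _ = 2 * max C 0 * M / Real.log M ^ 2 := by ring

/-! ### Hyperbola bound for `∑_{k ≤ K} (twist ⋆ twist)(k)` -/

/-- Truncation of `twist` to `n ≤ s`. [folklore] -/
def twistLow (s : ℕ) : ArithmeticFunction ℝ := ⟨fun n => if n ≤ s then twist n else 0, by simp⟩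

/-- Truncation of `twist` to `n > s`. [folklore] -/
def twistHigh (s : ℕ) : ArithmeticFunction ℝ := ⟨fun n => if s < n then twist n else 0, by simp⟩

/-- Unfolding of the lower truncation. [folklore] -/
theorem twistLow_apply (s n : ℕ) : twistLow s n = if n ≤ s then twist n else 0 := rfl

/-- Unfolding of the upper truncation. [folklore] -/
theorem twistHigh_apply (s n : ℕ) : twistHigh s n = if s < n then twist n else 0 := rfl

/-- `twist = twist·1_{≤ s} + twist·1_{> s}`. [folklore] -/
theorem twist_eq_low_add_high (s : ℕ) : twist = twistLow s + twistHigh s := by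
  ext n
  rw [ArithmeticFunction.add_apply, twistLow_apply, twistHigh_apply]
  split_ifs <;> first | (exfalso; omega) | simp

/-- `∑_{m ≤ T} (twist·1_{≤ s})(m) = twistSum(s)` for `s ≤ T`. [folklore] -/
theorem sum_twistLow_Ioc (s T : ℕ) (hT : s ≤ T) : ∑ m ∈ Ioc 0 T, twistLow s m = twistSum s := by
  unfold twistSum
  simp only [twistLow_apply]
  rw [← Finset.sum_filter]
  congr 1
  ext m
  simp only [Finset.mem_filter, Finset.mem_Ioc]
  omega

/-- `∑_{m ≤ T} (twist·1_{> s})(m) = twistSum(T) − twistSum(s)` for `s ≤ T`. [folklore] -/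
theorem sum_twistHigh_Ioc (s T : ℕ) (hT : s ≤ T) : ∑ m ∈ Ioc 0 T, twistHigh s m = twistSum T - twistSum s := by
  unfold twistSum
  simp only [twistHigh_apply]
  rw [← Finset.sum_filter]
  have hfil : (Ioc 0 T).filter (fun m => s < m) = Ioc s T := by
    ext m
    simp only [Finset.mem_filter, Finset.mem_Ioc]
    omega
  rw [hfil, ← Finset.sum_Ioc_consecutive (fun m => twist m) (Nat.zero_le s) hT]
  ring

/-- Symmetric Dirichlet hyperbola bound: `|∑_{k ≤ K} (twist ⋆ twist)(k)| ≤ D K (4 log s + 30)/log² s`, `s = ⌊√K⌋ ≥ 16`. [folklore] -/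
theorem hyperbola_bound {D : ℝ} (hD0 : 0 ≤ D)
    (hD : ∀ M : ℕ, 16 ≤ M → |twistSum M| ≤ D * M / Real.log M ^ 2) (K : ℕ) (hs : 16 ≤ Nat.sqrt K) :
    |∑ k ∈ Ioc 0 K, (twist * twist) k| ≤
      D * K * (4 * Real.log (Nat.sqrt K) + 30) / Real.log (Nat.sqrt K) ^ 2 := by
  set s := Nat.sqrt K with hsdef
  have hss : s * s ≤ K := Nat.sqrt_le K
  have hK : K < (s + 1) * (s + 1) := Nat.lt_succ_sqrt K
  have hsK : s ≤ K := le_trans (Nat.le_mul_self s) hss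
  set L := Real.log s with hL
  have hs1 : (1:ℝ) < s := by exact_mod_cast (lt_of_lt_of_le (by norm_num) hs)
  have hLpos : 0 < L := Real.log_pos hs1
  have hspos : (0:ℝ) < s := by linarith
  -- decomposition of `twist ⋆ twist`
  have hdec : twist * twist = twistLow s * twistLow s + twistLow s * twistHigh s + twistLow s * twistHigh s + twistHigh s * twistHigh s := by
    conv_lhs => rw [twist_eq_low_add_high s]
    ring
  -- the high-high part vanishes below `K`
  have hHH : ∑ k ∈ Ioc 0 K, (twistHigh s * twistHigh s) k = 0 := by
    rw [ArithmeticFunction.sum_Ioc_mul_eq_sum_sum]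
    refine Finset.sum_eq_zero fun n hn => ?_
    rw [twistHigh_apply]
    split_ifs with h
    · have hinner : ∑ m ∈ Ioc 0 (K / n), twistHigh s m = 0 := by
        refine Finset.sum_eq_zero fun m hm => ?_
        rw [Finset.mem_Ioc] at hm
        have h1 : K / n ≤ K / (s + 1) := Nat.div_le_div_left (by omega) (by omega)
        have h2 : K / (s + 1) < s + 1 := by
          rw [Nat.div_lt_iff_lt_mul (by omega)]; exact hK
        rw [twistHigh_apply, if_neg (by omega)]
      rw [hinner, mul_zero]
    · rw [zero_mul]
  -- the low-low part is `twistSum(s)²`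
  have hLL : ∑ k ∈ Ioc 0 K, (twistLow s * twistLow s) k = twistSum s * twistSum s := by
    rw [ArithmeticFunction.sum_Ioc_mul_eq_sum_sum]
    have hcongr : ∀ n ∈ Ioc 0 K, twistLow s n * ∑ m ∈ Ioc 0 (K / n), twistLow s m =
        (if n ≤ s then twist n else 0) * twistSum s := by
      intro n hn
      rw [twistLow_apply]
      split_ifs with h
      · rw [Finset.mem_Ioc] at hn
        rw [sum_twistLow_Ioc]
        rw [Nat.le_div_iff_mul_le (by omega)]
        calc s * n ≤ s * s := Nat.mul_le_mul_left s h
          _ ≤ K := hss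
      · rw [zero_mul, zero_mul]
    rw [Finset.sum_congr rfl hcongr, ← Finset.sum_mul, ← Finset.sum_filter]
    have hfil : (Ioc 0 K).filter (fun n => n ≤ s) = Ioc 0 s := by
      ext m
      simp only [Finset.mem_filter, Finset.mem_Ioc]
      omega
    rw [hfil]
    rfl
  -- the low-high part
  have hLH : |∑ k ∈ Ioc 0 K, (twistLow s * twistHigh s) k| ≤ 2 * D * K * (L + 6) / L ^ 2 := by
    rw [ArithmeticFunction.sum_Ioc_mul_eq_sum_sum]
    have hterm : ∀ n ∈ Ioc 0 K, |twistLow s n * ∑ m ∈ Ioc 0 (K / n), twistHigh s m| ≤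
        (if n ≤ s then Λ n / n else 0) * (2 * D * K / L ^ 2) := by
      intro n hn
      rw [Finset.mem_Ioc] at hn
      rw [twistLow_apply]
      split_ifs with h
      · have hnpos : (0:ℝ) < n := by exact_mod_cast hn.1
        have hsq : s ≤ K / n := by
          rw [Nat.le_div_iff_mul_le (by omega)]
          calc s * n ≤ s * s := Nat.mul_le_mul_left s h
            _ ≤ K := hss
        rw [sum_twistHigh_Ioc s (K / n) hsq, abs_mul]
        have hq16 : 16 ≤ K / n := le_trans hs hsq
        have hq1 : (1:ℝ) < ((K / n : ℕ) : ℝ) := by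
          exact_mod_cast (lt_of_lt_of_le (by norm_num) hq16)
        have hLq : L ≤ Real.log ((K / n : ℕ) : ℝ) :=
          Real.log_le_log hspos (by exact_mod_cast hsq)
        have hqle : ((K / n : ℕ) : ℝ) ≤ (K : ℝ) / n := Nat.cast_div_le
        have hsle : (s : ℝ) ≤ (K : ℝ) / n := le_trans (by exact_mod_cast hsq) hqle
        have hF1 : |twistSum (K / n)| ≤ D * ((K:ℝ) / n) / L ^ 2 := by
          calc |twistSum (K / n)| ≤ D * ((K / n : ℕ) : ℝ) / Real.log ((K / n : ℕ) : ℝ) ^ 2 := hD _ hq16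
            _ ≤ D * ((K / n : ℕ) : ℝ) / L ^ 2 := by
                apply div_le_div_of_nonneg_left (by positivity) (by positivity)
                exact pow_le_pow_left₀ hLpos.le hLq 2
            _ ≤ D * ((K:ℝ) / n) / L ^ 2 := by
                apply div_le_div_of_nonneg_right _ (by positivity)
                exact mul_le_mul_of_nonneg_left hqle hD0
        have hF2 : |twistSum s| ≤ D * ((K:ℝ) / n) / L ^ 2 := by
          calc |twistSum s| ≤ D * (s : ℝ) / L ^ 2 := hD s hs
            _ ≤ D * ((K:ℝ) / n) / L ^ 2 := by
                apply div_le_div_of_nonneg_right _ (by positivity)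
                exact mul_le_mul_of_nonneg_left hsle hD0
        have hdiff : |twistSum (K / n) - twistSum s| ≤ 2 * D * K / L ^ 2 / n := by
          calc |twistSum (K / n) - twistSum s| ≤ |twistSum (K / n)| + |twistSum s| := abs_sub _ _
            _ ≤ D * ((K:ℝ) / n) / L ^ 2 + D * ((K:ℝ) / n) / L ^ 2 := add_le_add hF1 hF2
            _ = 2 * D * K / L ^ 2 / n := by
                field_simp
                ring
        calc |twist n| * |twistSum (K / n) - twistSum s| ≤ Λ n * (2 * D * K / L ^ 2 / n) :=
              mul_le_mul (abs_twist_le n) hdiff (abs_nonneg _) ArithmeticFunction.vonMangoldt_nonneg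
          _ = Λ n / n * (2 * D * K / L ^ 2) := by
              field_simp
      · simp
    calc |∑ n ∈ Ioc 0 K, twistLow s n * ∑ m ∈ Ioc 0 (K / n), twistHigh s m|
        ≤ ∑ n ∈ Ioc 0 K, |twistLow s n * ∑ m ∈ Ioc 0 (K / n), twistHigh s m| :=
          Finset.abs_sum_le_sum_abs _ _
      _ ≤ ∑ n ∈ Ioc 0 K, (if n ≤ s then Λ n / n else 0) * (2 * D * K / L ^ 2) :=
          Finset.sum_le_sum hterm
      _ = (∑ n ∈ Ioc 0 s, Λ n / n) * (2 * D * K / L ^ 2) := by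
          rw [← Finset.sum_mul, ← Finset.sum_filter]
          have hfil : (Ioc 0 K).filter (fun n => n ≤ s) = Ioc 0 s := by
            ext m
            simp only [Finset.mem_filter, Finset.mem_Ioc]
            omega
          rw [hfil]
      _ ≤ (L + 6) * (2 * D * K / L ^ 2) := by
          apply mul_le_mul_of_nonneg_right _ (by positivity)
          have hm := Literature.NumberTheory.Sieve.SelbergSymmetry.abs_sum_vonMangoldt_div_sub_log_le
            hs1.le
          rw [Nat.floor_natCast] at hm
          linarith [(abs_le.1 hm).2]
      _ = 2 * D * K * (L + 6) / L ^ 2 := by ring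
  -- the square term
  have hFs : |twistSum s * twistSum s| ≤ 6 * D * K / L ^ 2 := by
    rw [abs_mul]
    have h1 : |twistSum s| ≤ D * s / L ^ 2 := hD s hs
    have h2 : |twistSum s| ≤ 6 * s := by
      calc |twistSum s| ≤ ψ s := abs_twistSum_le_psi s
        _ ≤ (Real.log 4 + 4) * s := Chebyshev.psi_le_const_mul_self hspos.le
        _ ≤ 6 * s := by
            apply mul_le_mul_of_nonneg_right _ hspos.le
            have : Real.log 4 = 2 * Real.log 2 := by
              rw [show (4:ℝ) = 2 ^ 2 by norm_num, Real.log_pow]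
              norm_num
            linarith [Real.log_two_lt_d9]
    calc |twistSum s| * |twistSum s| ≤ (D * s / L ^ 2) * (6 * s) :=
          mul_le_mul h1 h2 (abs_nonneg _) (by positivity)
      _ = 6 * D * ((s : ℝ) * s) / L ^ 2 := by ring
      _ ≤ 6 * D * K / L ^ 2 := by
          apply div_le_div_of_nonneg_right _ (by positivity)
          apply mul_le_mul_of_nonneg_left _ (by positivity)
          exact_mod_cast hss
  -- total
  have hsum : ∑ k ∈ Ioc 0 K, (twist * twist) k = twistSum s * twistSum s + ∑ k ∈ Ioc 0 K, (twistLow s * twistHigh s) k +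
      ∑ k ∈ Ioc 0 K, (twistLow s * twistHigh s) k + 0 := by
    rw [hdec]
    simp only [ArithmeticFunction.add_apply, Finset.sum_add_distrib]
    rw [hLL, hHH]
  rw [hsum, add_zero]
  calc |twistSum s * twistSum s + ∑ k ∈ Ioc 0 K, (twistLow s * twistHigh s) k + ∑ k ∈ Ioc 0 K, (twistLow s * twistHigh s) k|
      ≤ |twistSum s * twistSum s| + |∑ k ∈ Ioc 0 K, (twistLow s * twistHigh s) k| +
          |∑ k ∈ Ioc 0 K, (twistLow s * twistHigh s) k| := abs_add_three _ _ _
    _ ≤ 6 * D * K / L ^ 2 + 2 * D * K * (L + 6) / L ^ 2 + 2 * D * K * (L + 6) / L ^ 2 :=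
        add_le_add (add_le_add hFs hLH) hLH
    _ = D * K * (4 * L + 30) / L ^ 2 := by
        field_simp
        ring


/-! ### Odd multiples of three -/

/-- The nonnegative part `t₀(k) = 1_{k odd, 3 ∣ k} (Λ ⋆ Λ)(k)`. [folklore] -/
def oddMultThree (k : ℕ) : ℝ := if k % 2 = 1 ∧ k % 3 = 0 then (Λ * Λ) k else 0

/-- `t₀ ≥ 0`. [folklore] -/
theorem oddMultThree_nonneg (k : ℕ) : 0 ≤ oddMultThree k := by
  unfold oddMultThree; split_ifs
  · exact vonMangoldt_conv_nonneg k
  · exact le_rfl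


/-- `(twist ⋆ twist)(1) = (twist ⋆ twist)(2) = 0`. [folklore] -/
theorem sum_twist_conv_Ioc_two (K : ℕ) : ∑ k ∈ Ioc 2 K, (twist * twist) k = ∑ k ∈ Ioc 0 K, (twist * twist) k := by
  refine Finset.sum_subset (Finset.Ioc_subset_Ioc_left (Nat.zero_le 2)) fun k hk hk' => ?_
  have hk12 : k = 1 ∨ k = 2 := by
    rw [Finset.mem_Ioc] at hk hk'; omega
  rcases hk12 with rfl | rfl
  · rw [twist_mul_twist_apply, ArithmeticFunction.mul_apply, Nat.divisorsAntidiagonal_one]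
    simp
  · rw [twist_mul_twist_apply]
    simp [chi6]


/-- `T₀ ≥ log 3 · (θ(⌊(N+2)/3⌋) − log 2)` via the pairs `(3, p)`, `p` an odd prime. [folklore] -/
theorem oddMultThree_sum_lower (N : ℕ) :
    Real.log 3 * (θ ((N + 2) / 3 : ℕ) - Real.log 2) ≤ ∑ k ∈ Ioc 2 (N + 2), oddMultThree k := by
  set M : ℕ := (N + 2) / 3 with hM
  set P : Finset ℕ := (Ioc 0 M).filter (fun p => p.Prime ∧ p ≠ 2) with hP
  -- Step a/b: restrict the sum to `k = 3p`, `p` an odd prime `≤ M`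
  have hsub : P.image (fun p => 3 * p) ⊆ Ioc 2 (N + 2) := by
    intro k hk
    rw [Finset.mem_image] at hk
    obtain ⟨p, hp, rfl⟩ := hk
    rw [hP, Finset.mem_filter, Finset.mem_Ioc] at hp
    rw [Finset.mem_Ioc]
    have h3M : 3 * M ≤ N + 2 := by rw [hM]; exact Nat.mul_div_le (N + 2) 3
    omega
  have hinj : ∀ p ∈ P, ∀ q ∈ P, 3 * p = 3 * q → p = q := fun p _ q _ h => by omega
  have hstep1 : ∑ p ∈ P, oddMultThree (3 * p) ≤ ∑ k ∈ Ioc 2 (N + 2), oddMultThree k := by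
    rw [← Finset.sum_image hinj]
    exact Finset.sum_le_sum_of_subset_of_nonneg hsub fun k _ _ => oddMultThree_nonneg k
  -- Step c: each term is at least `log 3 * log p`
  have hstep2 : ∀ p ∈ P, Real.log 3 * Real.log p ≤ oddMultThree (3 * p) := by
    intro p hp
    rw [hP, Finset.mem_filter] at hp
    obtain ⟨-, hpr, hp2⟩ := hp
    have hodd : p % 2 = 1 := Nat.odd_iff.1 (hpr.odd_of_ne_two hp2)
    have hcond : (3 * p) % 2 = 1 ∧ (3 * p) % 3 = 0 := by omega
    unfold oddMultThree
    rw [if_pos hcond, ArithmeticFunction.mul_apply]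
    have hmem : ((3, p) : ℕ × ℕ) ∈ Nat.divisorsAntidiagonal (3 * p) := by
      rw [Nat.mem_divisorsAntidiagonal]
      exact ⟨rfl, by omega⟩
    refine le_trans (le_of_eq ?_) (Finset.single_le_sum (f := fun cd : ℕ × ℕ => Λ cd.1 * Λ cd.2)
      (fun cd _ => mul_nonneg ArithmeticFunction.vonMangoldt_nonneg
        ArithmeticFunction.vonMangoldt_nonneg) hmem)
    simp only
    rw [ArithmeticFunction.vonMangoldt_apply_prime Nat.prime_three,
      ArithmeticFunction.vonMangoldt_apply_prime hpr]
    push_cast; ring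
  -- Step d: the primes `≤ M` other than `2` carry `θ(M) − log 2` at least
  have hθ : θ (M : ℝ) = ∑ p ∈ (Ioc 0 M).filter Nat.Prime, Real.log p := by
    rw [Chebyshev.theta, Nat.floor_natCast]
  have hstep3 : θ (M : ℝ) - Real.log 2 ≤ ∑ p ∈ P, Real.log p := by
    rw [hθ, ← Finset.sum_filter_add_sum_filter_not ((Ioc 0 M).filter Nat.Prime) (fun p => p ≠ 2),
      Finset.filter_filter, ← hP]
    have hrest : ∑ p ∈ ((Ioc 0 M).filter Nat.Prime).filter (fun p => ¬ p ≠ 2), Real.log p ≤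
        Real.log 2 := by
      calc ∑ p ∈ ((Ioc 0 M).filter Nat.Prime).filter (fun p => ¬ p ≠ 2), Real.log p
          ≤ ∑ p ∈ ({2} : Finset ℕ), Real.log p := by
            refine Finset.sum_le_sum_of_subset_of_nonneg (fun p hp => ?_)
              (fun p _ _ => Real.log_natCast_nonneg p)
            rw [Finset.mem_filter] at hp
            rw [Finset.mem_singleton]
            simpa using hp.2
        _ = Real.log 2 := by simp
    linarith
  -- assemble
  have hlog3 : 0 ≤ Real.log 3 := Real.log_nonneg (by norm_num)
  calc Real.log 3 * (θ (M : ℝ) - Real.log 2)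
      ≤ Real.log 3 * ∑ p ∈ P, Real.log p := mul_le_mul_of_nonneg_left hstep3 hlog3
    _ = ∑ p ∈ P, Real.log 3 * Real.log p := Finset.mul_sum _ _ _
    _ ≤ ∑ p ∈ P, oddMultThree (3 * p) := Finset.sum_le_sum hstep2
    _ ≤ ∑ k ∈ Ioc 2 (N + 2), oddMultThree k := hstep1


/-! ### Eventual estimates -/

/-- `3 + log x + 2√x log x = o(x)`. [folklore] -/
theorem isLittleO_err :
    (fun x : ℝ => 3 + (Real.log x + 2 * (Real.sqrt x * Real.log x))) =o[atTop] (fun x : ℝ => x) := by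
  have h1 : (fun x : ℝ => Real.log x) =o[atTop] (fun x : ℝ => x) := Real.isLittleO_log_id_atTop
  have h2 : (fun x : ℝ => Real.sqrt x * Real.log x) =o[atTop] (fun x : ℝ => x) := by
    have hlog : Real.log =o[atTop] (fun x : ℝ => x ^ (1/2 : ℝ)) :=
      isLittleO_log_rpow_atTop (by norm_num)
    have h := (Asymptotics.isBigO_refl (fun x : ℝ => x ^ (1/2 : ℝ)) atTop).mul_isLittleO hlog
    refine h.congr' ?_ ?_
    · filter_upwards with x
      rw [Real.sqrt_eq_rpow]
    · filter_upwards [eventually_ge_atTop (0:ℝ)] with x hx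
      rw [← Real.sqrt_eq_rpow, Real.mul_self_sqrt hx]
  have h3 : (fun _ : ℝ => (3:ℝ)) =o[atTop] (fun x : ℝ => x) :=
    Asymptotics.isLittleO_const_id_atTop (3:ℝ)
  exact h3.add (h1.add (h2.const_mul_left 2))

/-- `T₀ ≥ 0.22 x` for large `x` (Mathlib's `Chebyshev.theta_ge`, `log 3 ≥ 1`, `log 2 ≥ 0.6931`). [folklore] -/
theorem oddMultThree_sum_eventually : ∀ᶠ x : ℝ in atTop, 0.22 * x ≤ ∑ k ∈ Ioc 2 (⌊x⌋₊ + 2), oddMultThree k := by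
  filter_upwards [isLittleO_err.def (by norm_num : (0:ℝ) < 0.011), eventually_ge_atTop (4:ℝ)]
    with x hx hx4
  set N := ⌊x⌋₊ with hN
  set M : ℕ := (N + 2) / 3 with hM
  have hxpos : 0 < x := by linarith
  have hT0 := oddMultThree_sum_lower N
  rw [← hM] at hT0
  have hθ := Chebyshev.theta_ge M
  -- facts about `N`, `M`
  have hNx : (N:ℝ) ≤ x := Nat.floor_le hxpos.le
  have hxN : x < N + 1 := Nat.lt_floor_add_one x
  have hN4 : 4 ≤ N := by
    rw [hN, Nat.le_floor_iff hxpos.le]; exact_mod_cast hx4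
  have h3M : N ≤ 3 * M := by omega
  have hMN : M ≤ N := by omega
  have hM1 : 1 ≤ M := by omega
  have hM1r : (1:ℝ) ≤ M := by exact_mod_cast hM1
  have hMx : (M:ℝ) ≤ x := le_trans (by exact_mod_cast hMN) hNx
  have hMge : (x - 1) / 3 ≤ M := by
    have : (N:ℝ) ≤ 3 * M := by exact_mod_cast h3M
    linarith
  -- numerical logarithms
  have hlog2 : (0.6931:ℝ) ≤ Real.log 2 := by linarith [Real.log_two_gt_d9]
  have hlog2' : Real.log 2 ≤ 1 := by linarith [Real.log_two_lt_d9]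
  have hlog3 : (1:ℝ) ≤ Real.log 3 := by
    rw [Real.le_log_iff_exp_le (by norm_num)]
    linarith [Real.exp_one_lt_d9]
  -- error terms
  have hE1 : Real.log ((M:ℝ) + 1) ≤ 1 + Real.log x := by
    calc Real.log ((M:ℝ) + 1) ≤ Real.log (2 * x) := Real.log_le_log (by linarith) (by linarith)
      _ = Real.log 2 + Real.log x := Real.log_mul (by norm_num) hxpos.ne'
      _ ≤ 1 + Real.log x := by linarith
  have hE2 : 2 * Real.sqrt M * Real.log M ≤ 2 * (Real.sqrt x * Real.log x) := by
    have ha : Real.sqrt M ≤ Real.sqrt x := Real.sqrt_le_sqrt hMx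
    have hb : Real.log M ≤ Real.log x := Real.log_le_log (by linarith) hMx
    have hc : 0 ≤ Real.log (M:ℝ) := Real.log_nonneg hM1r
    have := mul_le_mul ha hb hc (Real.sqrt_nonneg x)
    linarith
  have hx' : 3 + (Real.log x + 2 * (Real.sqrt x * Real.log x)) ≤ 0.011 * x := by
    have h := hx
    rw [Real.norm_eq_abs, Real.norm_eq_abs, abs_of_pos hxpos] at h
    exact le_trans (le_abs_self _) h
  have hbr : 0.22 * x ≤
      (M:ℝ) * Real.log 2 - Real.log ((M:ℝ) + 1) - 2 * Real.sqrt M * Real.log M - Real.log 2 := by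
    have hMlog : (x - 1) / 3 * Real.log 2 ≤ M * Real.log 2 :=
      mul_le_mul_of_nonneg_right hMge (by linarith)
    have hcoef : (x - 1) / 3 * 0.6931 ≤ (x - 1) / 3 * Real.log 2 :=
      mul_le_mul_of_nonneg_left hlog2 (by linarith)
    linarith
  have hθ' : 0.22 * x ≤ θ (M:ℝ) - Real.log 2 := by linarith
  have hpos : 0 ≤ θ (M:ℝ) - Real.log 2 := by linarith
  calc 0.22 * x ≤ θ (M:ℝ) - Real.log 2 := hθ'
    _ ≤ Real.log 3 * (θ (M:ℝ) - Real.log 2) := le_mul_of_one_le_left hpos hlog3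
    _ ≤ _ := hT0

/-- `|T₁| ≤ 0.01 x` for large `x`. [folklore] -/
theorem twist_conv_sum_eventually : ∀ᶠ x : ℝ in atTop, |∑ k ∈ Ioc 2 (⌊x⌋₊ + 2), (twist * twist) k| ≤ 0.01 * x := by
  obtain ⟨D, hD0, hD⟩ := exists_twistSum_bound
  set L₀ : ℝ := 6800 * (D + 1) with hL₀
  have hL₀1 : (1:ℝ) ≤ L₀ := by rw [hL₀]; nlinarith
  have hL₀pos : 0 < L₀ := by linarith
  set m₀ : ℕ := ⌈Real.exp L₀⌉₊ with hm₀
  have hm₀ge : Real.exp L₀ ≤ m₀ := Nat.le_ceil _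
  have hexp : L₀ + 1 ≤ Real.exp L₀ := Real.add_one_le_exp L₀
  have hm₀16r : (16:ℝ) ≤ m₀ := by linarith
  have hm₀16 : 16 ≤ m₀ := by exact_mod_cast hm₀16r
  filter_upwards [eventually_ge_atTop (((m₀ * m₀ : ℕ) : ℝ)), eventually_ge_atTop (2:ℝ)]
    with x hx hx2
  set K : ℕ := ⌊x⌋₊ + 2 with hK
  have hxpos : 0 < x := by linarith
  have hms : m₀ ≤ Nat.sqrt K := by
    rw [Nat.le_sqrt]
    have : m₀ * m₀ ≤ ⌊x⌋₊ := by
      rw [Nat.le_floor_iff hxpos.le]; exact hx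
    omega
  have hs16 : 16 ≤ Nat.sqrt K := le_trans hm₀16 hms
  have hb := hyperbola_bound hD0 hD K hs16
  rw [sum_twist_conv_Ioc_two]
  refine hb.trans ?_
  set s : ℕ := Nat.sqrt K with hs
  set L := Real.log s with hLdef
  have hm₀pos : (0:ℝ) < m₀ := by linarith
  have hspos : (0:ℝ) < s := by exact_mod_cast (lt_of_lt_of_le (by norm_num) hs16)
  have hL : L₀ ≤ L := by
    rw [hLdef]
    calc L₀ = Real.log (Real.exp L₀) := (Real.log_exp L₀).symm
      _ ≤ Real.log m₀ := Real.log_le_log (Real.exp_pos _) hm₀ge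
      _ ≤ Real.log s := Real.log_le_log hm₀pos (by exact_mod_cast hms)
  have hL1 : 1 ≤ L := le_trans hL₀1 hL
  have hLpos : 0 < L := by linarith
  have hKx : (K:ℝ) ≤ x + 2 := by
    rw [hK]; push_cast; linarith [Nat.floor_le hxpos.le]
  have hK0 : (0:ℝ) ≤ K := by positivity
  have h1 : D * K * (4 * L + 30) / L ^ 2 ≤ D * K * (34 / L) := by
    rw [mul_div_assoc]
    apply mul_le_mul_of_nonneg_left _ (by positivity)
    rw [div_le_div_iff₀ (by positivity) hLpos]
    nlinarith [mul_nonneg hLpos.le (sub_nonneg.2 hL1)]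
  have h2 : D * K * (34 / L) ≤ D * K * (34 / L₀) := by
    apply mul_le_mul_of_nonneg_left _ (by positivity)
    exact div_le_div_of_nonneg_left (by norm_num) hL₀pos hL
  have h3 : D * K * (34 / L₀) ≤ (K:ℝ) / 200 := by
    rw [hL₀, mul_div_assoc', div_le_div_iff₀ (by positivity) (by norm_num)]
    nlinarith [mul_nonneg hD0 hK0]
  have h4 : (K:ℝ) / 200 ≤ 0.01 * x := by linarith
  linarith

end TwistedModSix

end Literature.NumberTheory.Sieve

end
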